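import Summits.AtomisticToContinuum.HydrodynamicLimit.Theses.LindebergRandomFuture
import Summits.AtomisticToContinuum.HydrodynamicLimit.Theorems.LambertianContactSwapLambertianEulerOfHearts
import Summits.AtomisticToContinuum.HydrodynamicLimit.Theses.LambertianContactSwap
import Summits.AtomisticToContinuum.HydrodynamicLimit.Theorems.LambertianContactSwapLambertianEulerArchimedes
import Summits.AtomisticToContinuum.HydrodynamicLimit.Theorems.LambertianContactSwapLambertianEulerLambertLaw
import Summits.AtomisticToContinuum.HydrodynamicLimit.Theorems.LambertianContactSwapLambertianEulerPovzner
import HarnessLib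

/-! TTRL-lite variant V13057 of stmt-AtomisticToContinuum-11854 -/

namespace Summit.AtomisticToContinuum.HydrodynamicLimit.Theorems

open scoped BigOperators Topology ENNReal InnerProductSpace
open MeasureTheory ProbabilityTheory Filter Set InformationTheory
open Literature.MathematicalPhysics.KineticTheory
open Literature.Analysis.FluidPDE Literature.Analysis.FluidPDE.Alexander
open Summit.AtomisticToContinuum.HydrodynamicLimit.Theses.LambertianContactSwap

/-- TTRL-lite variant V13057 (move `negate`, op `exponential_tails_insufficient`) of
`stub_kineticOneBlockInMeanLambda`: with merely exponential tails the remainder `exp (-(κ |log ε|)) = ε ^ κ`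
is NOT below `ε / 3` along a sequence `ε → 0`; already `κ = 1` witnesses this (`ε > ε / 3`), with
`ε = min ε₀ 1 / 2`. Boundary case pinning "exponential tails do not close the log-shell". -/
theorem stub_kineticOneBlockInMeanLambda_var13057 :
    ∃ κ : ℝ, 0 < κ ∧ ∀ ε₀ : ℝ, 0 < ε₀ →
      ∃ ε : ℝ, 0 < ε ∧ ε < ε₀ ∧ ε / 3 < Real.exp (-(κ * |Real.log ε|)) := by
  refine ⟨1, one_pos, fun ε₀ hε₀ => ?_⟩
  have hεpos : 0 < min ε₀ 1 / 2 := by positivity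
  have hεlt : min ε₀ 1 / 2 < ε₀ := by
    have := min_le_left ε₀ 1
    linarith
  have hε1 : min ε₀ 1 / 2 < 1 := by
    have := min_le_right ε₀ 1
    linarith
  refine ⟨min ε₀ 1 / 2, hεpos, hεlt, ?_⟩
  have hlog : Real.log (min ε₀ 1 / 2) < 0 := Real.log_neg hεpos hε1
  rw [abs_of_neg hlog, one_mul, neg_neg, Real.exp_log hεpos]
  linarith

end Summit.AtomisticToContinuum.HydrodynamicLimit.Theorems
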